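import Mathlib.Analysis.Calculus.Deriv.Pi
import Mathlib.Analysis.Calculus.FDeriv.Prod
import Mathlib.Analysis.Calculus.ContDiff.Operations
import Mathlib.Analysis.Normed.Operator.BoundedLinearMaps
import Literature.NumberTheory.Transcendental.KZCalculusProofs
import Literature.NumberTheory.Transcendental.KZCubicalCalculus
import Literature.NumberTheory.Transcendental.KZLogCalculusProofs
import Literature.NumberTheory.Transcendental.KZProductIdeal
import Literature.NumberTheory.Transcendental.SemialgebraicLineDeriv
import Literature.NumberTheory.Transcendental.NashCubes

/-!
# `StokesGeneration` (stmt-KontsevichZagierPeriods-3586), line `Sketch`: stub `stub_cubeCalibration`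

Support file for the registered stub `stub_cubeCalibration` (cube calibration, (C)) of the crux
`StokesGeneration` (route UnfoldedStokes, line `Sketch` = card cube-type-a-generation). Statement:
for `G` of class `C¹` and `ℚ`-semialgebraic on an open `U ⊇ [0,1]ᵐ` and ANY coordinate `i : Fin m`,
the closed-cube representation `[[0,1]ᵐ, ∂G/∂xᵢ − G|_{xᵢ=1} + G|_{xᵢ=0}]` — Ayoub's generator of
type (a) of the cube presentation of effective periods [Ayoub 2014, Def. 10] — is a relation of the
four-move Kontsevich–Zagier calculus of `KZCalculus.lean` [Kontsevich–Zagier 2001, §1.2]. This is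
also, verbatim, the body of the support item `AyoubRelACubeCalibration`
(stmt-KontsevichZagierPeriods-0543, route AyoubSpecialisation) after its two (discharged)
Tarski–Seidenberg antecedents.

## Proof

* `cubeCalibration_last` — the case of the LAST coordinate. With `R₁ = [[0,1]ᵏ⁺¹, ∂_last H]` and
  `R_b = [[0,1]ᵏ, x ↦ H (x, 1) − H (x, 0)]`:
  `[R₁] − [R_b]` is ONE Newton–Leibniz move (rule (3): base the `k`-cube, bounds `0 ≤ 1`, the band
  is the `(k+1)`-cube by `KZ.cube_succ_eq`, primitive `H`, fibrewise derivative by the chain rule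
  `HasFDerivAt.comp_hasDerivAt` with `hasDerivAt_update`); the re-inflation
  `[R_b.slab 0] − [R_b]` of the two restriction terms is ONE Newton–Leibniz move with primitive
  `t · (H (x, 1) − H (x, 0))` (`KZ.IntegralRep.of_slab_sub_of_mem_newtonLeibnizRel`), the slab
  `[0,1]ᵏ × [0, 1]` being the `(k+1)`-cube again; and `[R₁] − [r] − [R_b.slab 0]` is ONE
  integrand-additivity move (rule (1b)), since `Fin.snoc (Fin.init w) c = update w last c`.
* `cubeCalibration_perm` — an arbitrary coordinate `i` is brought last by a coordinate permutation
  `e` with `e i = last` (rule (2), `KZ.of_sub_of_reindex_mem_relations`, `|det| = 1`); the reindexed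
  representation is the last-coordinate datum of `H = G ∘ (· ∘ e)` on `U' = (· ∘ e)⁻¹ U`
  (`fderiv` of the composite with the linear coordinate map, `Function.update_apply_equiv_apply`).
* `stub_cubeCalibration` — `m = k + 1` (as `i : Fin m`), `e = Equiv.swap i (Fin.last k)`.

Semialgebraicity inputs (all proved in the tree, via Tarski–Seidenberg): partial derivatives of
semialgebraic functions (`IsSemialgebraicFunOn.fderiv_apply_single`, Basu–Pollack–Roy Prop. 3.22),
composition with polynomial maps (`IsSemialgebraicFunOn.comp_isSemialgebraicMapOn_holds`),
differences (`IsSemialgebraicFunOn.fun_sub`), coordinate relabelling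
(`IsSemialgebraicFunOn.comp_equiv`). Integrability: continuity on the compact cube.

References: J. Ayoub, *Periods and the conjectures of Grothendieck and Kontsevich–Zagier*, EMS
Newsl. 91 (2014), Def. 10; M. Kontsevich, D. Zagier, *Periods* (2001), §1.2 rules (1)–(3).
-/

noncomputable section

-- `Summit.KontsevichZagierPeriods.KontsevichZagierPeriods.…` is the tree's mandated layout (single-conjunct summit).
set_option linter.dupNamespace false

namespace Summit.KontsevichZagierPeriods.KontsevichZagierPeriods.StokesGenerationLine

open MeasureTheory Set
open Literature.NumberTheory.Transcendental
open Literature.NumberTheory.Transcendental.KZ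

/-! ## Tuple bookkeeping -/

/-- `Fin.snoc (Fin.init w) c` is `w` with its last coordinate set to `c`. [folklore] -/
theorem snoc_init_eq_update {k : ℕ} (w : Fin (k + 1) → ℝ) (c : ℝ) :
    Fin.snoc (Fin.init w) c = Function.update w (Fin.last k) c := by
  conv_rhs => rw [← Fin.snoc_init_self (Function.update w (Fin.last k) c)]
  rw [Fin.init_update_last, Function.update_self]

/-- For a permutation `e` of the coordinates, `{w | w ∘ e ∈ [0,1]ᵐ} = [0,1]ᵐ`. [folklore] -/
theorem setOf_comp_perm_mem_cube {m : ℕ} (e : Equiv.Perm (Fin m)) :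
    {w : Fin m → ℝ | (fun j => w (e j)) ∈ cube m} = cube m := by
  ext w
  simp only [mem_setOf_eq, mem_cube]
  exact ⟨fun h j => by simpa using h (e.symm j), fun h j => h (e j)⟩

/-- Restricting a function to the face `x ↦ (x, c)` (`c ∈ ℚ ∩ [0,1]`) of the cube: if `H` is
`ℚ`-semialgebraic and continuous on `U' ⊇ [0,1]ᵏ⁺¹`, then `x ↦ H (Fin.snoc x c)` is
`ℚ`-semialgebraic and continuous on `[0,1]ᵏ` (composition with the polynomial map
`x ↦ (x, c)`). [cite: BochnakCosteRoy1998, Prop. 2.2.6] -/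
theorem face_semialgebraic_continuousOn {k : ℕ} {U' : Set (Fin (k + 1) → ℝ)}
    {H : (Fin (k + 1) → ℝ) → ℝ} (hCU' : cube (k + 1) ⊆ U') (hH : IsSemialgebraicFunOn ℚ U' H)
    (hHc : ContinuousOn H U') (c : ℝ) (hq : ∃ q : ℚ, (q : ℝ) = c) (hc : c ∈ Icc (0 : ℝ) 1) :
    IsSemialgebraicFunOn ℚ (cube k) (fun x => H (Fin.snoc x c)) ∧
      ContinuousOn (fun x => H (Fin.snoc x c)) (cube k) := by
  obtain ⟨q, rfl⟩ := hq
  have hmaps : ∀ x ∈ cube k, (Fin.snoc x (q : ℝ) : Fin (k + 1) → ℝ) ∈ U' :=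
    fun x hx => hCU' (snoc_mem_cube_iff.2 ⟨hx, hc.1, hc.2⟩)
  have hγ : Continuous fun x : Fin k → ℝ => (Fin.snoc x (q : ℝ) : Fin (k + 1) → ℝ) :=
    Continuous.finSnoc continuous_id continuous_const
  refine ⟨?_, hHc.comp hγ.continuousOn fun x hx => hmaps x hx⟩
  have hP : IsSemialgebraicMapOn ℚ (cube k)
      (fun x : Fin k → ℝ => (Fin.snoc x (q : ℝ) : Fin (k + 1) → ℝ)) := by
    refine (isSemialgebraicMapOn_aeval isSemialgebraic_cube (fun j : Fin (k + 1) =>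
      (Fin.snoc (α := fun _ : Fin (k + 1) => MvPolynomial (Fin k) ℚ)
        (fun i : Fin k => MvPolynomial.X i) (MvPolynomial.C q) j))).congr fun x _ => ?_
    funext j
    refine Fin.lastCases ?_ (fun i => ?_) j
    · simp only [Fin.snoc_last, MvPolynomial.aeval_C, eq_ratCast]
    · simp only [Fin.snoc_castSucc, MvPolynomial.aeval_X]
  exact IsSemialgebraicFunOn.comp_isSemialgebraicMapOn_holds hH hP fun x hx => hmaps x hx

/-! ## The last coordinate -/

/-- **Cube calibration along the last coordinate.** For `H` of class `C¹` and `ℚ`-semialgebraic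
on an open `U' ⊇ [0,1]ᵏ⁺¹`, a representation `r` on the closed `(k+1)`-cube with integrand
`∂H/∂x_last − H|_{x_last=1} + H|_{x_last=0}` is a relation of the KZ calculus: with
`R₁ = [[0,1]ᵏ⁺¹, ∂_last H]`, `R_b = [[0,1]ᵏ, H(·,1) − H(·,0)]`,
`[r] = ([R₁] − [R_b]) − ([R₁] − [r] − [R_b.slab 0]) − ([R_b.slab 0] − [R_b])`, the three brackets
being a Newton–Leibniz move (rule (3)), an integrand-additivity move (rule (1b)) and the slab
Newton–Leibniz move (rule (3)). [cite: Ayoub2014, Def. 10] -/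
theorem cubeCalibration_last (k : ℕ) (H : (Fin (k + 1) → ℝ) → ℝ) (U' : Set (Fin (k + 1) → ℝ))
    (hU'o : IsOpen U') (hCU' : cube (k + 1) ⊆ U') (hH : IsSemialgebraicFunOn ℚ U' H)
    (hH1 : ContDiffOn ℝ 1 H U') (r : IntegralRep (k + 1)) (hdom : r.domain = cube (k + 1))
    (hr : ∀ w ∈ r.domain, r.integrand w = fderiv ℝ H w (Pi.single (Fin.last k) 1) -
      H (Function.update w (Fin.last k) 1) + H (Function.update w (Fin.last k) 0)) :
    of r ∈ relations := by
  -- regularity of `H` on `U'`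
  have hHc : ContinuousOn H U' := hH1.continuousOn
  have hHd : ∀ x ∈ U', DifferentiableAt ℝ H x := fun x hx =>
    (hH1.differentiableOn_one x hx).differentiableAt (hU'o.mem_nhds hx)
  have hH'c : ContinuousOn (fun w => fderiv ℝ H w (Pi.single (Fin.last k) 1)) U' :=
    (hH1.continuousOn_fderiv_of_isOpen hU'o le_rfl).clm_apply continuousOn_const
  have hH's : IsSemialgebraicFunOn ℚ U' (fun w => fderiv ℝ H w (Pi.single (Fin.last k) 1)) :=
    hH.fderiv_apply_single hU'o hHd (Fin.last k)
  have hsnoc : ∀ x ∈ cube k, ∀ t ∈ Icc (0 : ℝ) 1, (Fin.snoc x t : Fin (k + 1) → ℝ) ∈ U' :=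
    fun x hx t ht => hCU' (snoc_mem_cube_iff.2 ⟨hx, ht.1, ht.2⟩)
  -- `R₁ = [cube, ∂_last H]`
  let R₁ : IntegralRep (k + 1) := ⟨cube (k + 1), fun w => fderiv ℝ H w (Pi.single (Fin.last k) 1),
    isSemialgebraic_cube, hH's.mono hCU' isSemialgebraic_cube,
    (hH'c.mono hCU').integrableOn_compact isCompact_cube⟩
  -- `R_b = [cube k, H(·,1) − H(·,0)]`
  obtain ⟨hs1, hc1⟩ := face_semialgebraic_continuousOn hCU' hH hHc 1 ⟨1, Rat.cast_one⟩
    ⟨zero_le_one, le_rfl⟩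
  obtain ⟨hs0, hc0⟩ := face_semialgebraic_continuousOn hCU' hH hHc 0 ⟨0, Rat.cast_zero⟩
    ⟨le_rfl, zero_le_one⟩
  let Rb : IntegralRep k := ⟨cube k, fun x => H (Fin.snoc x 1) - H (Fin.snoc x 0),
    isSemialgebraic_cube, hs1.fun_sub hs0, (hc1.sub hc0).integrableOn_compact isCompact_cube⟩
  -- the slab of `R_b` at level `0` lives on the `(k+1)`-cube
  have hslab : (Rb.slab 0).domain = cube (k + 1) := by
    show {z : Fin (k + 1) → ℝ | Fin.init z ∈ cube k ∧ ((0 : ℕ) : ℝ) ≤ z (Fin.last k) ∧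
      z (Fin.last k) ≤ (0 : ℕ) + 1} = cube (k + 1)
    rw [cube_succ_eq, Nat.cast_zero, zero_add]
  -- (N) Newton–Leibniz along the last coordinate: `[R₁] − [R_b]`
  have hN : of R₁ - of Rb ∈ relations := by
    refine newtonLeibnizRel_subset_relations ⟨k, R₁, Rb, fun _ => 0, fun _ => 1, H,
      hH.mono hCU' isSemialgebraic_cube, ?_, ?_, fun _ _ => zero_le_one, cube_succ_eq k, ?_, ?_,
      fun _ _ => rfl, rfl⟩
    · simpa using isSemialgebraicFunOn_const_natCast (isSemialgebraic_cube (n := k)) 0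
    · simpa using isSemialgebraicFunOn_const_natCast (isSemialgebraic_cube (n := k)) 1
    · intro x hx
      have hγ : Continuous fun t : ℝ => (Fin.snoc x t : Fin (k + 1) → ℝ) :=
        Continuous.finSnoc continuous_const continuous_id
      exact hHc.comp hγ.continuousOn fun t ht => hsnoc x hx t ht
    · intro x hx t ht
      have hp : (Fin.snoc x t : Fin (k + 1) → ℝ) ∈ U' := hsnoc x hx t (Ioo_subset_Icc_self ht)
      have hfun : (fun s : ℝ => (Fin.snoc x s : Fin (k + 1) → ℝ)) =
          Function.update (Fin.snoc x (0 : ℝ) : Fin (k + 1) → ℝ) (Fin.last k) := by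
        funext s
        rw [Fin.update_snoc_last]
      have hγ : HasDerivAt (fun s : ℝ => (Fin.snoc x s : Fin (k + 1) → ℝ))
          (Pi.single (Fin.last k) 1) t := by
        rw [hfun]
        exact hasDerivAt_update _ _ _
      exact (hHd _ hp).hasFDerivAt.comp_hasDerivAt t hγ
  -- (A) integrand additivity: `∂H = r.integrand + (H(·,1) − H(·,0)) ∘ init` on the cube
  have hA : of R₁ - of r - of (Rb.slab 0) ∈ relations := by
    refine integrandAddRel_subset_relations ⟨k + 1, R₁, r, Rb.slab 0, hdom, hslab, ?_, rfl⟩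
    intro w hw
    have hw' : w ∈ r.domain := by rw [hdom]; exact hw
    show fderiv ℝ H w (Pi.single (Fin.last k) 1) =
      r.integrand w + (H (Fin.snoc (Fin.init w) 1) - H (Fin.snoc (Fin.init w) 0))
    rw [hr w hw', snoc_init_eq_update, snoc_init_eq_update]
    ring
  -- (S) re-inflation of the restriction terms: the slab move
  have hS : of (Rb.slab 0) - of Rb ∈ relations :=
    newtonLeibnizRel_subset_relations (Rb.of_slab_sub_of_mem_newtonLeibnizRel 0)
  have key : of r = (of R₁ - of Rb) - (of R₁ - of r - of (Rb.slab 0)) - (of (Rb.slab 0) - of Rb) := by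
    abel
  rw [key]
  exact relations.sub_mem (relations.sub_mem hN hA) hS

/-! ## An arbitrary coordinate, by a coordinate permutation -/

/-- **Cube calibration along any coordinate, given a permutation bringing it last.** If `e` is a
permutation of `Fin (k+1)` with `e i = last`, the type-(a) representation for the coordinate `i`
of `G` (class `C¹`, `ℚ`-semialgebraic on an open `U ⊇ [0,1]ᵏ⁺¹`) is a relation: the coordinate
relabelling `r ↦ r.reindex e` is a change-of-variables move (rule (2),
`KZ.of_sub_of_reindex_mem_relations`), and `r.reindex e` is the last-coordinate datum of
`H = G ∘ (· ∘ e)` on `(· ∘ e)⁻¹ U` (`cubeCalibration_last`). [cite: Ayoub2014, Def. 10] -/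
theorem cubeCalibration_perm (k : ℕ) (i : Fin (k + 1)) (e : Equiv.Perm (Fin (k + 1)))
    (hei : e i = Fin.last k) (G : (Fin (k + 1) → ℝ) → ℝ) (U : Set (Fin (k + 1) → ℝ))
    (hUo : IsOpen U) (hCU : cube (k + 1) ⊆ U) (hG : IsSemialgebraicFunOn ℚ U G)
    (hG1 : ContDiffOn ℝ 1 G U) (r : IntegralRep (k + 1)) (hdom : r.domain = cube (k + 1))
    (hr : ∀ x ∈ r.domain, r.integrand x =
      fderiv ℝ G x (Pi.single i 1) - G (Function.update x i 1) + G (Function.update x i 0)) :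
    of r ∈ relations := by
  have hesymm : e.symm (Fin.last k) = i := by rw [← hei, Equiv.symm_apply_apply]
  -- the transposed data
  set U' : Set (Fin (k + 1) → ℝ) := {w | (fun j => w (e j)) ∈ U} with hU'
  set H : (Fin (k + 1) → ℝ) → ℝ := fun w => G (fun j => w (e j)) with hH
  have hLc : ContDiff ℝ 1 (fun (w : Fin (k + 1) → ℝ) (j : Fin (k + 1)) => w (e j)) :=
    contDiff_pi.2 fun j => contDiff_apply ℝ ℝ (e j)
  have hU'o : IsOpen U' := hUo.preimage hLc.continuous
  have hCU' : cube (k + 1) ⊆ U' := fun w hw => hCU (mem_cube.2 fun j => mem_cube.1 hw (e j))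
  have hH' : IsSemialgebraicFunOn ℚ U' H := hG.comp_equiv e
  have hH1 : ContDiffOn ℝ 1 H U' := hG1.comp hLc.contDiffOn fun w hw => hw
  -- coordinates: `update` and `Pi.single` through the relabelling
  have hupd : ∀ (w : Fin (k + 1) → ℝ) (c : ℝ),
      (fun j => Function.update w (Fin.last k) c (e j)) = Function.update (fun j => w (e j)) i c := by
    intro w c
    funext j
    rw [Function.update_apply_equiv_apply, hesymm]
    rfl
  have hsingle : (fun j => (Pi.single (Fin.last k) (1 : ℝ) : Fin (k + 1) → ℝ) (e j)) =
      Pi.single i 1 := by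
    funext j
    rcases eq_or_ne j i with rfl | hj
    · rw [hei, Pi.single_eq_same, Pi.single_eq_same]
    · have hne : e j ≠ Fin.last k := fun h => hj (e.injective (h.trans hei.symm))
      rw [Pi.single_eq_of_ne hj, Pi.single_eq_of_ne hne]
  -- the partial derivative of the composite
  have hfd : ∀ w : Fin (k + 1) → ℝ, (fun j => w (e j)) ∈ U →
      fderiv ℝ H w (Pi.single (Fin.last k) 1) = fderiv ℝ G (fun j => w (e j)) (Pi.single i 1) := by
    intro w hx
    have hGd : DifferentiableAt ℝ G (fun j => w (e j)) :=
      (hG1.differentiableOn_one _ hx).differentiableAt (hUo.mem_nhds hx)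
    have hLd : HasFDerivAt (fun (w : Fin (k + 1) → ℝ) (j : Fin (k + 1)) => w (e j))
        (ContinuousLinearMap.pi fun j =>
          ContinuousLinearMap.proj (R := ℝ) (φ := fun _ : Fin (k + 1) => ℝ) (e j)) w :=
      hasFDerivAt_pi.2 fun j => hasFDerivAt_apply (e j) w
    have hHd : HasFDerivAt H ((fderiv ℝ G (fun j => w (e j))).comp
        (ContinuousLinearMap.pi fun j =>
          ContinuousLinearMap.proj (R := ℝ) (φ := fun _ : Fin (k + 1) => ℝ) (e j))) w :=
      hGd.hasFDerivAt.comp w hLd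
    rw [hHd.fderiv]
    show fderiv ℝ G (fun j => w (e j))
        (fun j => (Pi.single (Fin.last k) (1 : ℝ) : Fin (k + 1) → ℝ) (e j)) = _
    rw [hsingle]
  -- the reindexed representation is the last-coordinate datum of `H`
  have hdom' : (r.reindex e).domain = cube (k + 1) := by
    rw [IntegralRep.reindex_domain, hdom]
    exact setOf_comp_perm_mem_cube e
  have hint' : ∀ w ∈ (r.reindex e).domain, (r.reindex e).integrand w =
      fderiv ℝ H w (Pi.single (Fin.last k) 1) - H (Function.update w (Fin.last k) 1) +
        H (Function.update w (Fin.last k) 0) := by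
    intro w hw
    have hx : (fun j => w (e j)) ∈ r.domain := hw
    have hxU : (fun j => w (e j)) ∈ U := hCU (by rw [← hdom]; exact hx)
    have h1 : H (Function.update w (Fin.last k) 1) = G (Function.update (fun j => w (e j)) i 1) := by
      simp only [hH, hupd]
    have h0 : H (Function.update w (Fin.last k) 0) = G (Function.update (fun j => w (e j)) i 0) := by
      simp only [hH, hupd]
    show r.integrand (fun j => w (e j)) = _
    rw [hr _ hx, hfd w hxU, h1, h0]
  have hcore := cubeCalibration_last k H U' hU'o hCU' hH' hH1 (r.reindex e) hdom' hint'
  have key : of r = (of r - of (r.reindex e)) + of (r.reindex e) := by abel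
  rw [key]
  exact relations.add_mem (of_sub_of_reindex_mem_relations r e) hcore

/-! ## The stub -/

/-- STUB (C) cube calibration — Ayoub's type-(a) generator is a relation of the four-move
calculus for EVERY coordinate `i` (not only the last): for `G` `C¹` and `ℚ`-semialgebraic on an open
`U ⊇ [0,1]ᵐ`, the closed-cube representation with integrand `∂G/∂xᵢ − G|_{xᵢ=1} + G|_{xᵢ=0}` lies
in `KZ.relations` (coordinate transposition `(i last)` by rule 2, Newton–Leibniz along the last
coordinate by rule 3, re-inflation of the two restriction terms by rule 3 with primitive
`x_last · G(update x i c)`, integrand additivity). This is the body of the support item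
`AyoubRelACubeCalibration` (stmt-KontsevichZagierPeriods-0543, route AyoubSpecialisation) without its
two Tarski–Seidenberg antecedents (`IsSemialgebraicFunOn.add/mul`, discharged in the tree).
[cite: Ayoub2014, Def. 10] -/
theorem stub_cubeCalibration :
    ∀ (m : ℕ) (i : Fin m) (G : (Fin m → ℝ) → ℝ) (U : Set (Fin m → ℝ)), IsOpen U →
      Set.pi Set.univ (fun _ : Fin m => Set.Icc (0:ℝ) 1) ⊆ U → IsSemialgebraicFunOn ℚ U G →
      ContDiffOn ℝ 1 G U →
      ∀ (r : IntegralRep m), r.domain = Set.pi Set.univ (fun _ : Fin m => Set.Icc (0:ℝ) 1) →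
      (∀ x ∈ r.domain, r.integrand x =
        fderiv ℝ G x (Pi.single i 1) - G (Function.update x i 1) + G (Function.update x i 0)) →
      of r ∈ relations := by
  intro m
  cases m with
  | zero => exact fun i => i.elim0
  | succ k =>
    intro i G U hUo hCU hG hG1 r hdom hr
    rw [← cube_eq_pi] at hCU hdom
    exact cubeCalibration_perm k i (Equiv.swap i (Fin.last k)) (Equiv.swap_apply_left _ _) G U hUo
      hCU hG hG1 r hdom hr

end Summit.KontsevichZagierPeriods.KontsevichZagierPeriods.StokesGenerationLine

end
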